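import Mathlib.Order.PiLex
import Literature.Computability.AlgebraicComplexity.DM16NonCommutativeRank

/-!
# Landsberg's Toeplitz blow-up of `𝒳(p, 2p+1)` is invertible over every field —
# discharge of [DM16, Prop 4.6] (`DerksenMakam2018_prop_4_6`)

Sources: [DM16] H. Derksen, V. Makam, *On non-commutative rank and tensor rank*, LMA 66 (2018) =
arXiv:1606.06701, Prop 4.6 p. 9 (attributed to [Lan15] J. M. Landsberg, *Nontriviality of equations
and explicit tensors in `ℂ^m ⊗ ℂ^m ⊗ ℂ^m` of border rank at least `2m − 2`*, JPAA 219 (2015));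
[DM19] H. Derksen, V. Makam, *Explicit tensors of border rank at least `2d−2` in `K^d ⊗ K^d ⊗ K^d` in
arbitrary characteristic*, LMA 67 (2019) = arXiv:1709.06131, Prop 1.8 p. 3 and §5 p. 8 (the same
invertibility over EVERY field: `det = ± (t₁ ⋯ t_m)^{C(2p,p)}`).

The statement (tree vocabulary, `…/DM16NonCommutativeRank.lean`): `landsbergMatrix K p =
∑_i L_{e_i} ⊗ S_{i−p}` — rows `Λ^{p+1} K^{2p+1} ⊗ K^{p+1}` indexed by `(T, j)` (`T` a `(p+1)`-subset of
`{0,…,2p}`, `j ≤ p`), columns by `(S, k)` (`S` a `p`-subset, `k ≤ p`); the entry at `((T,j),(S,k))` is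
`± 1` if `T = S ∪ {i}` with `j + p = k + i`, and `0` otherwise. `DerksenMakam2018_prop_4_6 K p` says it
has full rank `C(2p+1,p)·(p+1)`.

THE PROOF HERE is a simplification of [DM19, §5] ("elusive entries", Prop 5.11/Cor 5.12: at most
one permutation contributes the monomial `(t₁⋯t_m)^{C(2p,p)}` to `det`, after a torus-scaling
argument §2–3 showing `det` is a multiple of that monomial). We show directly that the bipartite
SUPPORT graph of the matrix has a unique perfect matching, in the following effective form, and
never compute a determinant:
* the matching: row `(T, j)` ↔ column `col (T,j) := (T ∖ {t_j}, j + p − t_j)`, where `t_j` is the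
  `j`-th smallest element of `T` (`DM16Landsberg.ptr`); the entry there is `± 1`
  (`landsbergMatrix_col_ne_zero`), and `col` is injective (`col_injective`), hence bijective;
* the potential: to a row `(T, j)` attach the word `key (T,j) : Fin (2p+1) → ℕ`, `x ↦ 0` if `x ∉ T`,
  `x ↦ 1` if `x = t_j`, `x ↦ 2` if `x ∈ T ∖ {t_j}`, ordered LEXICOGRAPHICALLY from position `0`
  (`Pi.Lex`); then every nonzero entry off the matching increases the key:
  `landsbergMatrix K p r (col r') ≠ 0`, `r ≠ r'` ⟹ `key r < key r'` (`key_lt_key_of_ne`). [If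
  `T = S ∪ {i}`, `T' = S ∪ {t'}` with `t'` the pointer of `r'` and `i ≠ t'`: for `i < t'` the pointer
  `t` of `r` lies in `S` below `i` and the words first differ at `t` (`1 < 2`); for `i > t'` they first
  differ at `t'` (`0 < 1`) — a count of members/non-members of `S` below `i` and `t'`
  (`below_add_below_compl`).]
* hence `M v = 0` forces `v = 0`: at a row `r₀` maximising the key among `{r : v (col r) ≠ 0}` the
  `r₀`-th coordinate of `M v` is `± v (col r₀) ≠ 0` (`landsbergMatrix_mulVec_injective`); so the
  rank is the number of columns (`rank_landsbergMatrix`), over EVERY field (also characteristic `2`).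
Consequences: `DerksenMakam2018_prop_4_6_holds` (the named fact, which binds `[CharZero K]`),
and the printed route [DM16, Prop 4.6 ⟹ Cor 4.7 ⟹ Thm 1.15] of `…/DM16NonCommutativeRank.lean`
(`DerksenMakam2018_thm_1_15_of_prop_4_6`) is now unconditional as printed
(`DerksenMakam2018_thm_1_15_via_landsberg`; the tree's `DerksenMakam2018_thm_1_15_holds` used a
different route). Honest framing: linear algebra of one explicit `0/±1` matrix; nothing here bears
on `VP ≠ VNP`.
-/

open Finset

namespace Literature.Computability.AlgebraicComplexity

/-! ## 1. Counting members below a point; the `j`-th smallest element -/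

namespace DM16Landsberg

variable {n : ℕ}

/-- Number of elements of `A` below `x`. [cite: DerksenMakam2018BorderRank, §5, p. 8] locator: paper:arxiv-1709.06131 p0008.txt:L22 -/
def below (A : Finset (Fin n)) (x : Fin n) : ℕ := ((Finset.Iio x).filter (· ∈ A)).card

/-- Members and non-members of `A` below `x` together number `x`.
[cite: DerksenMakam2018BorderRank, §5, p. 8] locator: paper:arxiv-1709.06131 p0008.txt:L22 -/
theorem below_add_below_compl (A : Finset (Fin n)) (x : Fin n) : below A x + below Aᶜ x = x := by
  unfold below
  have h : (Finset.Iio x).filter (· ∈ Aᶜ) = (Finset.Iio x).filter (fun y => ¬ y ∈ A) :=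
    Finset.filter_congr fun y _ => by rw [Finset.mem_compl]
  rw [h, Finset.card_filter_add_card_filter_not, Fin.card_Iio]

/-- `below A` is monotone. [cite: DerksenMakam2018BorderRank, §5, p. 8] locator: paper:arxiv-1709.06131 p0008.txt:L22 -/
theorem below_mono (A : Finset (Fin n)) {x y : Fin n} (h : x ≤ y) : below A x ≤ below A y :=
  Finset.card_le_card (Finset.filter_subset_filter _ (Finset.Iio_subset_Iio h))

/-- `below A` is strictly monotone at members of `A`.
[cite: DerksenMakam2018BorderRank, §5, p. 8] locator: paper:arxiv-1709.06131 p0008.txt:L22 -/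
theorem below_lt_below (A : Finset (Fin n)) {x y : Fin n} (hx : x ∈ A) (h : x < y) :
    below A x < below A y := by
  unfold below
  refine Finset.card_lt_card ((Finset.ssubset_iff_of_subset
    (Finset.filter_subset_filter _ (Finset.Iio_subset_Iio h.le))).2 ⟨x, ?_, ?_⟩)
  · exact Finset.mem_filter.2 ⟨Finset.mem_Iio.2 h, hx⟩
  · exact fun hx' => lt_irrefl x (Finset.mem_Iio.1 (Finset.mem_filter.1 hx').1)

/-- `below A` is injective on `A`. [cite: DerksenMakam2018BorderRank, §5, p. 8] locator: paper:arxiv-1709.06131 p0008.txt:L22 -/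
theorem below_injOn (A : Finset (Fin n)) {x y : Fin n} (hx : x ∈ A) (hy : y ∈ A)
    (hxy : below A x = below A y) : x = y := by
  rcases lt_trichotomy x y with h | h | h
  · exact absurd hxy (below_lt_below A hx h).ne
  · exact h
  · exact absurd hxy (below_lt_below A hy h).ne'

/-- `below A x ≤ |A|`. [cite: DerksenMakam2018BorderRank, §5, p. 8] locator: paper:arxiv-1709.06131 p0008.txt:L22 -/
theorem below_le_card (A : Finset (Fin n)) (x : Fin n) : below A x ≤ A.card :=
  Finset.card_le_card fun _ hy => (Finset.mem_filter.1 hy).2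

/-- `below` only depends on membership below the point.
[cite: DerksenMakam2018BorderRank, §5, p. 8] locator: paper:arxiv-1709.06131 p0008.txt:L22 -/
theorem below_congr {A B : Finset (Fin n)} {x : Fin n} (h : ∀ y < x, (y ∈ A ↔ y ∈ B)) :
    below A x = below B x := by
  unfold below
  rw [Finset.filter_congr fun y hy => h y (Finset.mem_Iio.1 hy)]

/-- Inserting the point itself does not change the count below it.
[cite: DerksenMakam2018BorderRank, §5, p. 8] locator: paper:arxiv-1709.06131 p0008.txt:L22 -/
theorem below_insert_self (A : Finset (Fin n)) (a : Fin n) : below (insert a A) a = below A a :=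
  below_congr fun y hy => by rw [Finset.mem_insert, or_iff_right hy.ne]

/-- Erasing the point itself does not change the count below it.
[cite: DerksenMakam2018BorderRank, §5, p. 8] locator: paper:arxiv-1709.06131 p0008.txt:L22 -/
theorem below_erase_self (A : Finset (Fin n)) (a : Fin n) : below (A.erase a) a = below A a :=
  below_congr fun y hy => by rw [Finset.mem_erase, and_iff_right hy.ne]

variable {p : ℕ}

/-- The `j`-th smallest element `t_j` of a `(p+1)`-set `T` (`0`-indexed): the "pointer" of the
row `(T, j)`. [cite: DerksenMakam2018BorderRank, Def 5.9, p. 8] locator: paper:arxiv-1709.06131 p0008.txt:L50 -/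
def ptr (T : ExtIdx n (p + 1)) (j : Fin (p + 1)) : Fin n := T.1.orderEmbOfFin T.2 j

/-- `t_j ∈ T`. [cite: DerksenMakam2018BorderRank, Def 5.9, p. 8] locator: paper:arxiv-1709.06131 p0008.txt:L50 -/
theorem ptr_mem (T : ExtIdx n (p + 1)) (j : Fin (p + 1)) : ptr T j ∈ T.1 :=
  Finset.orderEmbOfFin_mem _ _ _

/-- Exactly `j` elements of `T` lie below `t_j`.
[cite: DerksenMakam2018BorderRank, Def 5.9, p. 8] locator: paper:arxiv-1709.06131 p0008.txt:L50 -/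
theorem below_ptr (T : ExtIdx n (p + 1)) (j : Fin (p + 1)) : below T.1 (ptr T j) = j := by
  unfold below ptr
  have h : (Finset.Iio (T.1.orderEmbOfFin T.2 j)).filter (· ∈ T.1) =
      (Finset.Iio j).image (T.1.orderEmbOfFin T.2) := by
    ext x
    simp only [Finset.mem_filter, Finset.mem_Iio, Finset.mem_image]
    constructor
    · rintro ⟨hx, hxT⟩
      have hx' : x ∈ Set.range (T.1.orderEmbOfFin T.2) := by
        rw [Finset.range_orderEmbOfFin]
        exact hxT
      obtain ⟨j', rfl⟩ := hx'
      exact ⟨j', (T.1.orderEmbOfFin T.2).lt_iff_lt.1 hx, rfl⟩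
    · rintro ⟨j', hj', rfl⟩
      exact ⟨(T.1.orderEmbOfFin T.2).lt_iff_lt.2 hj', Finset.orderEmbOfFin_mem _ _ _⟩
  rw [h, Finset.card_image_of_injective _ (T.1.orderEmbOfFin T.2).injective, Fin.card_Iio]

/-- `ptr T` is injective. [cite: DerksenMakam2018BorderRank, Def 5.9, p. 8] locator: paper:arxiv-1709.06131 p0008.txt:L50 -/
theorem ptr_injective (T : ExtIdx n (p + 1)) : Function.Injective (ptr T) :=
  (T.1.orderEmbOfFin T.2).injective

/-- `j ≤ t_j`. [cite: DerksenMakam2018BorderRank, Lemma 5.10, p. 8] locator: paper:arxiv-1709.06131 p0008.txt:L53 -/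
theorem le_ptr (T : ExtIdx n (p + 1)) (j : Fin (p + 1)) : (j : ℕ) ≤ (ptr T j : ℕ) := by
  have h := below_add_below_compl T.1 (ptr T j)
  rw [below_ptr] at h
  omega

/-- `t_j ≤ j + p` for a `(p+1)`-subset of `{0, …, 2p}`.
[cite: DerksenMakam2018BorderRank, Lemma 5.10, p. 8] locator: paper:arxiv-1709.06131 p0008.txt:L53 -/
theorem ptr_le (T : ExtIdx (2 * p + 1) (p + 1)) (j : Fin (p + 1)) : (ptr T j : ℕ) ≤ j + p := by
  have h1 := below_add_below_compl T.1 (ptr T j)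
  rw [below_ptr] at h1
  have h2 : below T.1ᶜ (ptr T j) ≤ p :=
    (below_le_card _ _).trans (by rw [Finset.card_compl, T.2, Fintype.card_fin]; omega)
  omega

/-! ## 2. Rows, columns, the matching `col` and the entries of Landsberg's matrix -/

/-- If a `(p+1)`-set is `insert i S` for a `p`-set `S` then `i ∉ S`.
[cite: DerksenMakam2018BorderRank, Lemma 5.3, p. 8] locator: paper:arxiv-1709.06131 p0008.txt:L22 -/
theorem not_mem_of_eq_insert {T : ExtIdx n (p + 1)} {S : ExtIdx n p} {i : Fin n}
    (h : T.1 = insert i S.1) : i ∉ S.1 := by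
  intro hi
  have h2 := T.2
  rw [h, Finset.insert_eq_of_mem hi, S.2] at h2
  omega

/-- … and `i` is determined by `T` and `S`.
[cite: DerksenMakam2018BorderRank, Lemma 5.3, p. 8] locator: paper:arxiv-1709.06131 p0008.txt:L22 -/
theorem eq_of_eq_insert {T : ExtIdx n (p + 1)} {S : ExtIdx n p} {i i' : Fin n}
    (h : T.1 = insert i S.1) (h' : T.1 = insert i' S.1) : i = i' := by
  have hi : i ∈ T.1 := h ▸ Finset.mem_insert_self i S.1
  rw [h'] at hi
  rcases Finset.mem_insert.1 hi with h1 | h1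
  · exact h1
  · exact absurd h1 (not_mem_of_eq_insert h)

/-- **The matching**: the column `(T ∖ {t_j}, j + p − t_j)` of the row `(T, j)` (the "elusive
entry" of [DM19, Def 5.9] sits at this position).
[cite: DerksenMakam2018BorderRank, Def 5.9, p. 8] locator: paper:arxiv-1709.06131 p0008.txt:L50 -/
def col (r : ExtIdx (2 * p + 1) (p + 1) × Fin (p + 1)) : ExtIdx (2 * p + 1) p × Fin (p + 1) :=
  (⟨r.1.1.erase (ptr r.1 r.2), by rw [Finset.card_erase_of_mem (ptr_mem _ _), r.1.2]; rfl⟩,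
   ⟨r.2 + p - ptr r.1 r.2, by have := le_ptr r.1 r.2; omega⟩)

/-- The first component of `col r` is `T ∖ {t_j}`.
[cite: DerksenMakam2018BorderRank, Def 5.9, p. 8] locator: paper:arxiv-1709.06131 p0008.txt:L50 -/
@[simp] theorem col_fst_val (r : ExtIdx (2 * p + 1) (p + 1) × Fin (p + 1)) :
    (col r).1.1 = r.1.1.erase (ptr r.1 r.2) := rfl

/-- The second component of `col r` is `j + p − t_j`.
[cite: DerksenMakam2018BorderRank, Def 5.9, p. 8] locator: paper:arxiv-1709.06131 p0008.txt:L50 -/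
@[simp] theorem col_snd_val (r : ExtIdx (2 * p + 1) (p + 1) × Fin (p + 1)) :
    ((col r).2 : ℕ) = r.2 + p - ptr r.1 r.2 := rfl

/-- `col` is injective (the number of non-members of `S` below a non-member determines it).
[cite: DerksenMakam2018BorderRank, Cor 5.12, p. 8] locator: paper:arxiv-1709.06131 p0008.txt:L80 -/
theorem col_injective : Function.Injective (col (p := p)) := by
  rintro ⟨T, j⟩ ⟨T', j'⟩ h
  have hS : T.1.erase (ptr T j) = T'.1.erase (ptr T' j') := by
    have h1 := congrArg (fun c => c.1.1) h
    simpa only [col_fst_val] using h1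
  have hk : (j : ℕ) + p - ptr T j = j' + p - ptr T' j' := by
    have h1 := congrArg (fun c => (c.2 : ℕ)) h
    simpa only [col_snd_val] using h1
  have ht := le_ptr T j
  have ht' := le_ptr T' j'
  have hpt := ptr_le T j
  have hpt' := ptr_le T' j'
  have h1 : below (T.1.erase (ptr T j)) (ptr T j) = j := by rw [below_erase_self, below_ptr]
  have h1' : below (T'.1.erase (ptr T' j')) (ptr T' j') = j' := by rw [below_erase_self, below_ptr]
  have h2 := below_add_below_compl (T.1.erase (ptr T j)) (ptr T j)
  have h2' := below_add_below_compl (T'.1.erase (ptr T' j')) (ptr T' j')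
  rw [h1] at h2
  rw [h1'] at h2'
  have htt' : ptr T j = ptr T' j' := by
    refine below_injOn (T.1.erase (ptr T j))ᶜ (Finset.mem_compl.2 (Finset.notMem_erase _ _))
      (by rw [hS]; exact Finset.mem_compl.2 (Finset.notMem_erase _ _)) ?_
    have h3 : below (T.1.erase (ptr T j))ᶜ (ptr T' j') = below (T'.1.erase (ptr T' j'))ᶜ (ptr T' j') := by
      rw [hS]
    rw [h3]
    omega
  have hT : T = T' := by
    refine Subtype.ext ?_
    rw [← Finset.insert_erase (ptr_mem T j), ← Finset.insert_erase (ptr_mem T' j'), hS, htt']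
  subst hT
  have hj : j = j' := ptr_injective T htt'
  subst hj
  rfl

/-- Rows and columns are equinumerous: `C(2p+1, p+1) (p+1) = C(2p+1, p) (p+1)`.
[cite: DerksenMakam2018, §4, p. 9] locator: paper:arxiv-1606.06701 p0009.txt:L64 -/
theorem card_rows_eq_card_cols (p : ℕ) :
    Fintype.card (ExtIdx (2 * p + 1) (p + 1) × Fin (p + 1)) =
      Fintype.card (ExtIdx (2 * p + 1) p × Fin (p + 1)) := by
  rw [Fintype.card_prod, Fintype.card_prod, card_extIdx, card_extIdx, Nat.choose_symm_half]

/-- `col` is surjective. [cite: DerksenMakam2018BorderRank, Cor 5.12, p. 8] locator: paper:arxiv-1709.06131 p0008.txt:L80 -/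
theorem col_surjective : Function.Surjective (col (p := p)) :=
  ((Fintype.bijective_iff_injective_and_card _).2 ⟨col_injective, card_rows_eq_card_cols p⟩).2

variable {K : Type*} [Field K]

/-- **Entries of Landsberg's matrix**: at `((T,j),(S,k))` the sum over `i` of
`[T = S ∪ {i}] · (±1) · [j + p = k + i]`. [cite: DerksenMakam2018, Prop 4.6, p. 9] locator: paper:arxiv-1606.06701 p0009.txt:L66 -/
theorem landsbergMatrix_apply (r : ExtIdx (2 * p + 1) (p + 1) × Fin (p + 1))
    (c : ExtIdx (2 * p + 1) p × Fin (p + 1)) :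
    landsbergMatrix K p r c =
      ∑ i : Fin (2 * p + 1),
        if r.1.1 = insert i c.1.1 ∧ (r.2 : ℕ) + p = c.2 + i then wedgeSign K i c.1.1 else 0 := by
  unfold landsbergMatrix
  rw [Matrix.sum_apply]
  refine Finset.sum_congr rfl fun i _ => ?_
  rw [Matrix.kroneckerMap_apply]
  simp only [extMulMatrix, toeplitzShift, Matrix.of_apply]
  by_cases h1 : r.1.1 = insert i c.1.1 <;> by_cases h2 : (r.2 : ℕ) + p = c.2 + i <;> simp [h1, h2]

/-- The entry when `T = S ∪ {i}`: `± [j + p = k + i]`.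
[cite: DerksenMakam2018, Prop 4.6, p. 9] locator: paper:arxiv-1606.06701 p0009.txt:L66 -/
theorem landsbergMatrix_apply_of_eq_insert {r : ExtIdx (2 * p + 1) (p + 1) × Fin (p + 1)}
    {c : ExtIdx (2 * p + 1) p × Fin (p + 1)} {i : Fin (2 * p + 1)} (h : r.1.1 = insert i c.1.1) :
    landsbergMatrix K p r c = if (r.2 : ℕ) + p = c.2 + i then wedgeSign K i c.1.1 else 0 := by
  rw [landsbergMatrix_apply, Finset.sum_eq_single i]
  · simp only [h, true_and]
  · intro i' _ hi'
    have hne : r.1.1 ≠ insert i' c.1.1 := fun h' => hi' (eq_of_eq_insert h' h)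
    simp only [hne, false_and, if_false]
  · simp

/-- A nonzero entry forces `T = S ∪ {i}` and `j + p = k + i` for some `i`.
[cite: DerksenMakam2018, Prop 4.6, p. 9] locator: paper:arxiv-1606.06701 p0009.txt:L66 -/
theorem exists_of_landsbergMatrix_ne_zero {r : ExtIdx (2 * p + 1) (p + 1) × Fin (p + 1)}
    {c : ExtIdx (2 * p + 1) p × Fin (p + 1)} (h : landsbergMatrix K p r c ≠ 0) :
    ∃ i : Fin (2 * p + 1), r.1.1 = insert i c.1.1 ∧ (r.2 : ℕ) + p = c.2 + i := by
  rw [landsbergMatrix_apply] at h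
  obtain ⟨i, -, hi⟩ := Finset.exists_ne_zero_of_sum_ne_zero h
  by_contra hne
  push Not at hne
  exact hi (if_neg fun hh => hne i hh.1 hh.2)

/-- `wedgeSign = ±1 ≠ 0`. [cite: DerksenMakam2018, §4, p. 9] locator: paper:arxiv-1606.06701 p0009.txt:L3 -/
theorem wedgeSign_ne_zero (i : Fin n) (S : Finset (Fin n)) : wedgeSign K i S ≠ 0 :=
  pow_ne_zero _ (neg_ne_zero.2 one_ne_zero)

/-- **The matched entries are `± 1`**: `M[(T,j), col (T,j)] ≠ 0`.
[cite: DerksenMakam2018BorderRank, Lemma 5.10, p. 8] locator: paper:arxiv-1709.06131 p0008.txt:L53 -/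
theorem landsbergMatrix_col_ne_zero (r : ExtIdx (2 * p + 1) (p + 1) × Fin (p + 1)) :
    landsbergMatrix K p r (col r) ≠ 0 := by
  have h : r.1.1 = insert (ptr r.1 r.2) (col r).1.1 := by
    rw [col_fst_val, Finset.insert_erase (ptr_mem _ _)]
  rw [landsbergMatrix_apply_of_eq_insert h, if_pos]
  · exact wedgeSign_ne_zero _ _
  · rw [col_snd_val]
    have := ptr_le r.1 r.2
    omega

/-! ## 3. The lexicographic potential -/

/-- The word of a row: `0` off `T`, `1` at the pointer `t_j`, `2` on `T ∖ {t_j}`.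
[cite: DerksenMakam2018BorderRank, Prop 5.11, p. 8] locator: paper:arxiv-1709.06131 p0008.txt:L62 -/
def key (r : ExtIdx (2 * p + 1) (p + 1) × Fin (p + 1)) : Fin (2 * p + 1) → ℕ :=
  fun x => if x ∈ r.1.1 then (if x = ptr r.1 r.2 then 1 else 2) else 0

/-- **Triangularity**: a nonzero entry `M[r, col r']` off the matching (`r ≠ r'`) has
`key r < key r'` in the lexicographic order of words read from position `0`.
[cite: DerksenMakam2018BorderRank, Prop 5.11, p. 8] locator: paper:arxiv-1709.06131 p0008.txt:L62 -/
theorem key_lt_key_of_ne {r r' : ExtIdx (2 * p + 1) (p + 1) × Fin (p + 1)}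
    (hM : landsbergMatrix K p r (col r') ≠ 0) (hne : r ≠ r') : toLex (key r) < toLex (key r') := by
  obtain ⟨i, hT, hj⟩ := exists_of_landsbergMatrix_ne_zero hM
  rw [col_fst_val] at hT
  rw [col_snd_val] at hj
  -- names: `t`, `t'` the pointers, `S = T' ∖ {t'}`
  have ht'b := le_ptr r'.1 r'.2
  have ht'u := ptr_le r'.1 r'.2
  have hjj : (r.2 : ℕ) + ptr r'.1 r'.2 = r'.2 + i := by omega
  have hiS : i ∉ r'.1.1.erase (ptr r'.1 r'.2) :=
    not_mem_of_eq_insert (T := r.1) (S := (col r').1) hT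
  have ht'S : ptr r'.1 r'.2 ∉ r'.1.1.erase (ptr r'.1 r'.2) := Finset.notMem_erase _ _
  have hit' : i ≠ ptr r'.1 r'.2 := by
    rintro rfl
    apply hne
    have h1 : r.1 = r'.1 := Subtype.ext (by rw [hT, Finset.insert_erase (ptr_mem _ _)])
    have h2 : r.2 = r'.2 := Fin.ext (by omega)
    exact Prod.ext h1 h2
  -- the counts
  have hbt' : below (r'.1.1.erase (ptr r'.1 r'.2)) (ptr r'.1 r'.2) = r'.2 := by
    rw [below_erase_self, below_ptr]
  have hct' := below_add_below_compl (r'.1.1.erase (ptr r'.1 r'.2)) (ptr r'.1 r'.2)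
  rw [hbt'] at hct'
  have hbi : below r.1.1 i = below (r'.1.1.erase (ptr r'.1 r'.2)) i := by
    rw [hT, below_insert_self]
  have hci := below_add_below_compl (r'.1.1.erase (ptr r'.1 r'.2)) i
  have hbt : below r.1.1 (ptr r.1 r.2) = r.2 := below_ptr r.1 r.2
  -- membership dictionary below the three special points
  have hmem : ∀ x, x ≠ i → x ≠ ptr r'.1 r'.2 → (x ∈ r.1.1 ↔ x ∈ r'.1.1) := by
    intro x hxi hxt'
    rw [hT, Finset.mem_insert, or_iff_right hxi, Finset.mem_erase, and_iff_right hxt']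
  rcases lt_or_gt_of_ne hit' with hlt | hgt
  · -- `i < t'`: the pointer `t` of `r` is a member of `S` below `i`; first difference at `t`.
    have hz := below_lt_below (r'.1.1.erase (ptr r'.1 r'.2))ᶜ (Finset.mem_compl.2 hiS) hlt
    have hpos : (r.2 : ℕ) < below r.1.1 i := by omega
    have hti : ptr r.1 r.2 < i := by
      by_contra hle
      have := below_mono r.1.1 (not_lt.1 hle)
      omega
    have htS : ptr r.1 r.2 ∈ r'.1.1.erase (ptr r'.1 r'.2) := by
      have h := ptr_mem r.1 r.2
      rw [hT, Finset.mem_insert] at h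
      exact h.resolve_left hti.ne
    have htT' : ptr r.1 r.2 ∈ r'.1.1 := (Finset.mem_erase.1 htS).2
    have htt' : ptr r.1 r.2 ≠ ptr r'.1 r'.2 := (Finset.mem_erase.1 htS).1
    refine ⟨ptr r.1 r.2, fun x hx => ?_, ?_⟩
    · have hxi : x ≠ i := (hx.trans hti).ne
      have hxt' : x ≠ ptr r'.1 r'.2 := (hx.trans (hti.trans hlt)).ne
      have hxt : x ≠ ptr r.1 r.2 := hx.ne
      show key r x = key r' x
      simp [key, hmem x hxi hxt', hxt, hxt']
    · show key r (ptr r.1 r.2) < key r' (ptr r.1 r.2)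
      simp [key, ptr_mem, htT', htt']
  · -- `i > t'`: the pointer `t` of `r` lies above `i`; first difference at `t'` (`t' ∉ T`).
    have hz := below_lt_below (r'.1.1.erase (ptr r'.1 r'.2))ᶜ (Finset.mem_compl.2 ht'S) hgt
    have hlt : below r.1.1 i < r.2 := by omega
    have hti : i < ptr r.1 r.2 := by
      by_contra hle
      have := below_mono r.1.1 (not_lt.1 hle)
      omega
    have ht'T : ptr r'.1 r'.2 ∉ r.1.1 := by
      rw [hT, Finset.mem_insert, not_or]
      exact ⟨hit'.symm, ht'S⟩
    refine ⟨ptr r'.1 r'.2, fun x hx => ?_, ?_⟩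
    · have hxi : x ≠ i := (hx.trans hgt).ne
      have hxt' : x ≠ ptr r'.1 r'.2 := hx.ne
      have hxt : x ≠ ptr r.1 r.2 := (hx.trans (hgt.trans hti)).ne
      show key r x = key r' x
      simp [key, hmem x hxi hxt', hxt, hxt']
    · show key r (ptr r'.1 r'.2) < key r' (ptr r'.1 r'.2)
      simp [key, ht'T, ptr_mem]

/-! ## 4. Injectivity and full rank -/

/-- **`M v = 0 ⟹ v = 0`** for Landsberg's matrix, over every field.
[cite: DerksenMakam2018BorderRank, Prop 1.8, p. 3] locator: paper:arxiv-1709.06131 p0003.txt:L67 -/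
theorem landsbergMatrix_mulVec_eq_zero {v : ExtIdx (2 * p + 1) p × Fin (p + 1) → K}
    (hv : (landsbergMatrix K p).mulVec v = 0) : v = 0 := by
  classical
  by_contra hne
  obtain ⟨c₀, hc₀⟩ := Function.ne_iff.1 hne
  obtain ⟨r₁, rfl⟩ := col_surjective c₀
  obtain ⟨r₀, hr₀, hmax⟩ := Finset.exists_max_image
    (Finset.univ.filter fun r : ExtIdx (2 * p + 1) (p + 1) × Fin (p + 1) => v (col r) ≠ 0)
    (fun r => toLex (key r)) ⟨r₁, Finset.mem_filter.2 ⟨Finset.mem_univ _, hc₀⟩⟩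
  have hv₀ : v (col r₀) ≠ 0 := (Finset.mem_filter.1 hr₀).2
  have hrow : (landsbergMatrix K p).mulVec v r₀ = landsbergMatrix K p r₀ (col r₀) * v (col r₀) := by
    rw [Matrix.mulVec, dotProduct]
    refine Finset.sum_eq_single (col r₀) (fun c _ hc => ?_) (fun h => absurd (Finset.mem_univ _) h)
    obtain ⟨r', rfl⟩ := col_surjective c
    by_cases hvc : v (col r') = 0
    · rw [hvc, mul_zero]
    by_cases hM : landsbergMatrix K p r₀ (col r') = 0
    · rw [hM, zero_mul]
    have hr' : r₀ ≠ r' := fun h => hc (by rw [h])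
    exact absurd (hmax r' (Finset.mem_filter.2 ⟨Finset.mem_univ _, hvc⟩))
      (not_le.2 (key_lt_key_of_ne hM hr'))
  rw [hv, Pi.zero_apply] at hrow
  exact mul_ne_zero (landsbergMatrix_col_ne_zero r₀) hv₀ hrow.symm

end DM16Landsberg

open DM16Landsberg

variable {K : Type*} [Field K]

/-- **Landsberg's matrix is injective** (trivial kernel) over every field.
[cite: DerksenMakam2018BorderRank, Prop 1.8, p. 3] locator: paper:arxiv-1709.06131 p0003.txt:L67 -/
theorem landsbergMatrix_mulVec_injective (p : ℕ) :
    Function.Injective (landsbergMatrix K p).mulVecLin := by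
  rw [← LinearMap.ker_eq_bot, LinearMap.ker_eq_bot']
  intro v hv
  exact landsbergMatrix_mulVec_eq_zero hv

/-- **[DM16, Prop 4.6] / [DM19, Prop 1.8] over EVERY field: Landsberg's Toeplitz blow-up
`∑_i L_{e_i} ⊗ S_{i−p}` of `𝒳(p, 2p+1)` has full rank `C(2p+1,p)·(p+1)`** (it is square of that
size, so "invertible"). [cite: DerksenMakam2018BorderRank, Prop 1.8, p. 3] locator: paper:arxiv-1709.06131 p0003.txt:L67 -/
theorem rank_landsbergMatrix (p : ℕ) :
    (landsbergMatrix K p).rank = Fintype.card (ExtIdx (2 * p + 1) p × Fin (p + 1)) := by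
  unfold Matrix.rank
  rw [LinearMap.finrank_range_of_inj (landsbergMatrix_mulVec_injective p),
    Module.finrank_fintype_fun_eq_card]

/-- **DISCHARGE of the named fact `DerksenMakam2018_prop_4_6`** ([DM16, Prop 4.6] =
[Landsberg2015]; the fact binds characteristic `0`, the proof above needs no hypothesis on `K`).
[cite: DerksenMakam2018, Prop 4.6, p. 9] locator: paper:arxiv-1606.06701 p0009.txt:L66 -/
theorem DerksenMakam2018_prop_4_6_holds :
    ∀ (K : Type*) [Field K] [CharZero K] (p : ℕ), DerksenMakam2018_prop_4_6 K p :=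
  fun _ _ _ p => rank_landsbergMatrix p

/-- **[DM16, Thm 1.15] along the PRINTED route** (Prop 4.6 ⟹ Cor 4.7 ⟹ Thm 1.15), now
unconditional: `ncrk 𝒳(p,2p+1) / rk 𝒳(p,2p+1) = (2p+1)/(p+1)` in characteristic `0`.
[cite: DerksenMakam2018, Thm 1.15, p. 9] locator: paper:arxiv-1606.06701 p0009.txt:L81 -/
theorem DerksenMakam2018_thm_1_15_via_landsberg (K : Type*) [Field K] [CharZero K] (p : ℕ) :
    DerksenMakam2018_thm_1_15 K p :=
  DerksenMakam2018_thm_1_15_of_prop_4_6 (rank_landsbergMatrix p)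

end Literature.Computability.AlgebraicComplexity
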